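import Summits.Ventures.CertifiedManyBodySolver.Observables.StiffnessTLOddMomentLocalObs
import HarnessLib

/-!
# Ventures/CertifiedManyBodySolver — Observables: the IDENTIFICATION step of the odd-moment
# (Krylov-3) stiffness row `R-K3-TL`, discharged — `m₁`, `m₃` are translation averages of LOCAL
# COMMUTATOR observables, so the row adapter needs no identification hypothesis

HONEST FRAMING: one-sided CEILINGS on the flux stiffness (helicity modulus / superfluid weight); not
a superconductivity verdict; no stiffness floor follows from equal-time data and an energy window.

Cell `hubbard-obs` (D-0042), seat p2 (stiffness). The adapter `fluxStiffness_le_of_torusLimit_oddMoment_row`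
(`StiffnessTLOddMomentCeiling.lean`) carries an explicit IDENTIFICATION hypothesis `hId`: along torus-limit
ground-state sequences the per-site fixed-`λ` odd-moment functional
`oddMomentFunctional U δ λ L ψ = (½Re⟨ψ,𝒦ψ⟩ + 2λ m₁(ψ) + λ² m₃(ψ))/L²` converges to a given functional of the
limit state. With the local observables of `StiffnessTLOddMomentLocalObs.lean` this file PROVES it:

* for a vector `ψ` with `Hψ = Eψ` (`H = hubbardTorus 2 L 1 U`, `𝒥 = curOpTT' L 0`, `B = H𝒥 − 𝒥H`):
  `m₁(ψ) = Re⟨𝒥ψ,H𝒥ψ⟩ − E‖𝒥ψ‖² = ½Re⟨ψ,[𝒥,B]ψ⟩ = ½L² Re(torus average of d₁ in ψ)` (`L ≥ 9`) and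
  `m₃(ψ) = Re⟨Bψ,HBψ⟩ − E‖Bψ‖² = −½Re⟨ψ,[B,HB−BH]ψ⟩ = −½L² Re(torus average of m₃' in ψ)` (`L ≥ 15`)
  — the commutator of two translation sums is the translation sum of a LOCAL density
  (`expect_commutator_sum_relabel_translate`): `firstMoment_eq_torusAvgExpect`, `thirdMoment_eq_torusAvgExpect`;
* `oddMomentFunctional_eq_torusAvgExpect` (`L ≥ 15`, sector ground states):
  `oddMomentFunctional U δ λ L ψ = ½Re avg(k₀) + λ Re avg(d₁) − (λ²/2) Re avg(m₃')`;
* `tendsto_oddMomentFunctional_of_isTorusLimitOf` — **`hId` PROVED**: along every torus-limit ground-state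
  sequence the functional converges to `oddMomentLimitFunctional U λ ω = ½Re ω(k₀) + λ Re ω(d₁) − (λ²/2) Re ω(m₃')`;
* **`fluxStiffness_le_of_torusLimit_oddMoment_certificate`** (+ `_TT'zero` registry spelling) — the
  UNCONDITIONAL `R-K3-TL` adapter: a certificate `oddMomentLimitFunctional U λ ω ≤ q` on the torus-limit
  ground-state class gives `ρ_s ≤ q` (tree units; `D_s^{HVR} = ρ_s/2`, `D^{SWZ}/(πe²) = 2ρ_s`).

What stays OUTSIDE the kernel is only what every certified objective of the cell has outside it: the check
that the window-SDP objective words (`½kx + 2λU·d1U + λ²(U²m3T + U³m3U)`, `HOME/hubbard-obs-p2/ops/tl/README.md`)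
are the translation-reduced normal-ordered expansions of `½k₀`, `λ d₁`, `−(λ²/2) m₃'` (two-lineage
`MISMATCHES = 0`).

References: [Kohn1964]; [ScalapinoWhiteZhang1993] §II; [Lipparini2008] eqs. (8.30), (8.39);
[BohigasLaneMartorell1979]; [BratteliRobinsonII1997] §5.2.2, §6.2.1, Thm. 6.2.4; [BratteliRobinsonI1987] §4.3.1.
-/

noncomputable section

namespace Summit.Ventures.CertifiedManyBodySolver.Observables

open Matrix Finset Filter Topology
open Literature.MathematicalPhysics.QuantumLattice
open Literature.MathematicalPhysics.QuantumLattice.ThermodynamicLimit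
open Literature.MathematicalPhysics.QuantumFieldTheory
open Literature.Probability.LatticeModels
open scoped ComplexOrder ComplexConjugate Topology

/-! ### The moments `m₁`, `m₃` of an eigenvector as torus averages of local observables -/

section Finite

variable (L : ℕ) [NeZero L]

/-- **`m₁` is local**: for a vector `ψ` with `Hψ = Eψ` (`H = hubbardTorus 2 L 1 U`, `𝒥 = curOpTT' L 0`,
`L ≥ 9`), `Re⟨𝒥ψ, H𝒥ψ⟩ − E‖𝒥ψ‖² = ½ L² · Re(torus average of d₁ in ψ)`, `d₁ = firstMomentObs U`
(`= Re⟨ψ, 𝒥Bψ⟩ = ½Re⟨ψ,[𝒥,B]ψ⟩`, `B = H𝒥 − 𝒥H` anti-Hermitian, and `[𝒥, B]` is the translation sum of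
`Γ(d₁)`). [cite: Lipparini2008, eq. (8.30)] -/
theorem firstMoment_eq_torusAvgExpect (U : ℝ) (hL : 9 ≤ L) {E : ℝ} {ψ : Fock (Orb (FermionTorus 2 L))}
    (hE : hubbardTorus 2 L 1 U *ᵥ ψ = ((E : ℝ) : ℂ) • ψ) :
    (star (curOpTT' L 0 *ᵥ ψ) ⬝ᵥ (hubbardTorus 2 L 1 U *ᵥ (curOpTT' L 0 *ᵥ ψ))).re -
        E * (star (curOpTT' L 0 *ᵥ ψ) ⬝ᵥ (curOpTT' L 0 *ᵥ ψ)).re =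
      (L : ℝ) ^ 2 / 2 * (torusAvgExpectAt L (box 2 4) (firstMomentObs U) ψ).re := by
  have hΩ : Set.InjOn (Torus.proj (d := 2) L) ↑(box 2 4) := injOn_proj_box (by omega)
  have hZ3 : Set.InjOn (Torus.proj (d := 2) L) ↑(box 2 3) := injOn_proj_box (by omega)
  have h14 : box 2 1 ⊆ box 2 4 := box_subset_box (by norm_num)
  have h24 : box 2 2 ⊆ box 2 4 := box_subset_box (by norm_num)
  -- abbreviations (definitional)
  have hJ : (curOpTT' L 0)ᴴ = curOpTT' L 0 := (isHermitian_curOpTT' (L := L) 0).eq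
  -- (1) `m₁ = Re⟨ψ, 𝒥 B ψ⟩`
  have hJv : ∀ v : Fock (Orb (FermionTorus 2 L)),
      star (curOpTT' L 0 *ᵥ ψ) ⬝ᵥ v = star ψ ⬝ᵥ (curOpTT' L 0 *ᵥ v) := fun v => by
    rw [star_mulVec, hJ, ← dotProduct_mulVec]
  have hstep1 : (star (curOpTT' L 0 *ᵥ ψ) ⬝ᵥ (hubbardTorus 2 L 1 U *ᵥ (curOpTT' L 0 *ᵥ ψ))).re -
        E * (star (curOpTT' L 0 *ᵥ ψ) ⬝ᵥ (curOpTT' L 0 *ᵥ ψ)).re =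
      (star ψ ⬝ᵥ ((curOpTT' L 0 *
        (hubbardTorus 2 L 1 U * curOpTT' L 0 - curOpTT' L 0 * hubbardTorus 2 L 1 U)) *ᵥ ψ)).re := by
    rw [← mulVec_mulVec, sub_mulVec, ← mulVec_mulVec, ← mulVec_mulVec, hE, mulVec_smul, ← hJv,
      dotProduct_sub, dotProduct_smul, smul_eq_mul, Complex.sub_re, Complex.re_ofReal_mul]
  -- (2) `Re⟨ψ, 𝒥Bψ⟩ = ½Re⟨ψ, [𝒥,B]ψ⟩`
  have hXY : (curOpTT' L 0 * (hubbardTorus 2 L 1 U * curOpTT' L 0 - curOpTT' L 0 * hubbardTorus 2 L 1 U))ᴴ =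
      -((hubbardTorus 2 L 1 U * curOpTT' L 0 - curOpTT' L 0 * hubbardTorus 2 L 1 U) * curOpTT' L 0) := by
    rw [conjTranspose_mul, conjTranspose_commutator_curOpTT', hJ, neg_mul]
  rw [hstep1, re_star_dotProduct_mul_mulVec_eq_half _ _ hXY]
  -- (3) `[𝒥, B]` is the translation sum of `Γ(d₁)`
  have hcomm : star ψ ⬝ᵥ ((curOpTT' L 0 * (hubbardTorus 2 L 1 U * curOpTT' L 0 - curOpTT' L 0 * hubbardTorus 2 L 1 U) -
      (hubbardTorus 2 L 1 U * curOpTT' L 0 - curOpTT' L 0 * hubbardTorus 2 L 1 U) * curOpTT' L 0) *ᵥ ψ) =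
      ((L : ℂ) ^ 2) * torusAvgExpectAt L (box 2 4) (firstMomentObs U) ψ := by
    have h := expect_commutator_sum_relabel_translate L hΩ hZ3 h14 h24
      (fun z hz => by simpa using shiftSet_subset_box_add (subset_refl (box 2 1)) hz)
      (fun a ha c hc => by simpa using sub_mem_box_add ha hc) curBondObs_mem_carEvenSubalgebra
      (curDerivObs U) ψ
    rw [← curOpTT'_zero_eq_sum_translate L, ← hubbardTorus_commutator_curOpTT' L U (by omega)] at h
    exact h
  rw [hcomm, show ((L : ℂ) ^ 2 * torusAvgExpectAt L (box 2 4) (firstMomentObs U) ψ).re =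
      (L : ℝ) ^ 2 * (torusAvgExpectAt L (box 2 4) (firstMomentObs U) ψ).re by
    rw [← Complex.ofReal_natCast, ← Complex.ofReal_pow, Complex.re_ofReal_mul]]
  ring

/-- **`m₃` is local**: for a vector `ψ` with `Hψ = Eψ` and `B = H𝒥 − 𝒥H` (`L ≥ 15`),
`Re⟨Bψ, HBψ⟩ − E‖Bψ‖² = −½ L² · Re(torus average of m₃' in ψ)`, `m₃' = thirdMomentObs U`
(`= Re⟨Bψ, (HB−BH)ψ⟩ = −Re⟨ψ, B(HB−BH)ψ⟩ = −½Re⟨ψ,[B, HB−BH]ψ⟩`, and `[B, HB−BH]` is the translation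
sum of `Γ(m₃')`). [cite: Lipparini2008, eq. (8.30)] -/
theorem thirdMoment_eq_torusAvgExpect (U : ℝ) (hL : 15 ≤ L) {E : ℝ} {ψ : Fock (Orb (FermionTorus 2 L))}
    (hE : hubbardTorus 2 L 1 U *ᵥ ψ = ((E : ℝ) : ℂ) • ψ) :
    (star ((hubbardTorus 2 L 1 U * curOpTT' L 0 - curOpTT' L 0 * hubbardTorus 2 L 1 U) *ᵥ ψ) ⬝ᵥ
          (hubbardTorus 2 L 1 U *ᵥ
            ((hubbardTorus 2 L 1 U * curOpTT' L 0 - curOpTT' L 0 * hubbardTorus 2 L 1 U) *ᵥ ψ))).re -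
        E * (star ((hubbardTorus 2 L 1 U * curOpTT' L 0 - curOpTT' L 0 * hubbardTorus 2 L 1 U) *ᵥ ψ) ⬝ᵥ
          ((hubbardTorus 2 L 1 U * curOpTT' L 0 - curOpTT' L 0 * hubbardTorus 2 L 1 U) *ᵥ ψ)).re =
      -((L : ℝ) ^ 2 / 2) * (torusAvgExpectAt L (box 2 7) (thirdMomentObs U) ψ).re := by
  have hΩ : Set.InjOn (Torus.proj (d := 2) L) ↑(box 2 7) := injOn_proj_box (by omega)
  have hZ5 : Set.InjOn (Torus.proj (d := 2) L) ↑(box 2 5) := injOn_proj_box (by omega)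
  have h27 : box 2 2 ⊆ box 2 7 := box_subset_box (by norm_num)
  have h37 : box 2 3 ⊆ box 2 7 := box_subset_box (by norm_num)
  -- notation: `H`, `B = H𝒥 − 𝒥H`, `C = HB − BH`
  have hBa := conjTranspose_commutator_curOpTT' L U
  -- (1) `m₃ = Re⟨Bψ, Cψ⟩ = -Re⟨ψ, B C ψ⟩`
  have hstep1 :
      (star ((hubbardTorus 2 L 1 U * curOpTT' L 0 - curOpTT' L 0 * hubbardTorus 2 L 1 U) *ᵥ ψ) ⬝ᵥ
          (hubbardTorus 2 L 1 U *ᵥ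
            ((hubbardTorus 2 L 1 U * curOpTT' L 0 - curOpTT' L 0 * hubbardTorus 2 L 1 U) *ᵥ ψ))).re -
        E * (star ((hubbardTorus 2 L 1 U * curOpTT' L 0 - curOpTT' L 0 * hubbardTorus 2 L 1 U) *ᵥ ψ) ⬝ᵥ
          ((hubbardTorus 2 L 1 U * curOpTT' L 0 - curOpTT' L 0 * hubbardTorus 2 L 1 U) *ᵥ ψ)).re =
      -(star ψ ⬝ᵥ (((hubbardTorus 2 L 1 U * curOpTT' L 0 - curOpTT' L 0 * hubbardTorus 2 L 1 U) *
        (hubbardTorus 2 L 1 U * (hubbardTorus 2 L 1 U * curOpTT' L 0 - curOpTT' L 0 * hubbardTorus 2 L 1 U) -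
          (hubbardTorus 2 L 1 U * curOpTT' L 0 - curOpTT' L 0 * hubbardTorus 2 L 1 U) * hubbardTorus 2 L 1 U)) *ᵥ
            ψ)).re := by
    -- `Cψ = H(Bψ) - E•Bψ` and `⟨ψ, B w⟩ = -⟨Bψ, w⟩` (`B` anti-Hermitian)
    have hC : (hubbardTorus 2 L 1 U * (hubbardTorus 2 L 1 U * curOpTT' L 0 - curOpTT' L 0 * hubbardTorus 2 L 1 U) -
          (hubbardTorus 2 L 1 U * curOpTT' L 0 - curOpTT' L 0 * hubbardTorus 2 L 1 U) * hubbardTorus 2 L 1 U) *ᵥ ψ =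
        hubbardTorus 2 L 1 U *ᵥ ((hubbardTorus 2 L 1 U * curOpTT' L 0 - curOpTT' L 0 * hubbardTorus 2 L 1 U) *ᵥ ψ) -
          ((E : ℝ) : ℂ) • ((hubbardTorus 2 L 1 U * curOpTT' L 0 - curOpTT' L 0 * hubbardTorus 2 L 1 U) *ᵥ ψ) := by
      rw [sub_mulVec, ← mulVec_mulVec, ← mulVec_mulVec, hE, mulVec_smul]
    have hadj : ∀ w : Fock (Orb (FermionTorus 2 L)),
        star ψ ⬝ᵥ ((hubbardTorus 2 L 1 U * curOpTT' L 0 - curOpTT' L 0 * hubbardTorus 2 L 1 U) *ᵥ w) =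
          -(star ((hubbardTorus 2 L 1 U * curOpTT' L 0 - curOpTT' L 0 * hubbardTorus 2 L 1 U) *ᵥ ψ) ⬝ᵥ w) := by
      intro w
      rw [star_mulVec, ← dotProduct_mulVec, hBa, Matrix.neg_mulVec, dotProduct_neg, neg_neg]
    rw [← mulVec_mulVec, hC, mulVec_sub, mulVec_smul, dotProduct_sub, dotProduct_smul, smul_eq_mul, hadj, hadj]
    simp only [Complex.neg_re, Complex.sub_re, Complex.mul_re, Complex.ofReal_re, Complex.ofReal_im, zero_mul,
      sub_zero]
    ring
  -- (2) `Re⟨ψ, BCψ⟩ = ½Re⟨ψ, [B,C]ψ⟩` (`B` anti-Hermitian, `C` Hermitian)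
  have hCh : (hubbardTorus 2 L 1 U * (hubbardTorus 2 L 1 U * curOpTT' L 0 - curOpTT' L 0 * hubbardTorus 2 L 1 U) -
        (hubbardTorus 2 L 1 U * curOpTT' L 0 - curOpTT' L 0 * hubbardTorus 2 L 1 U) * hubbardTorus 2 L 1 U)ᴴ =
      hubbardTorus 2 L 1 U * (hubbardTorus 2 L 1 U * curOpTT' L 0 - curOpTT' L 0 * hubbardTorus 2 L 1 U) -
        (hubbardTorus 2 L 1 U * curOpTT' L 0 - curOpTT' L 0 * hubbardTorus 2 L 1 U) * hubbardTorus 2 L 1 U := by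
    have hH : (hubbardTorus 2 L 1 U)ᴴ = hubbardTorus 2 L 1 U :=
      (hamiltonian_isHermitian_and_commute_holds (fermionTorusGraph 2 L) 1 U).1
    rw [conjTranspose_sub, conjTranspose_mul, conjTranspose_mul, hBa, hH, neg_mul, mul_neg, neg_sub_neg]
  have hXY : ((hubbardTorus 2 L 1 U * curOpTT' L 0 - curOpTT' L 0 * hubbardTorus 2 L 1 U) *
        (hubbardTorus 2 L 1 U * (hubbardTorus 2 L 1 U * curOpTT' L 0 - curOpTT' L 0 * hubbardTorus 2 L 1 U) -
          (hubbardTorus 2 L 1 U * curOpTT' L 0 - curOpTT' L 0 * hubbardTorus 2 L 1 U) * hubbardTorus 2 L 1 U))ᴴ =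
      -((hubbardTorus 2 L 1 U * (hubbardTorus 2 L 1 U * curOpTT' L 0 - curOpTT' L 0 * hubbardTorus 2 L 1 U) -
          (hubbardTorus 2 L 1 U * curOpTT' L 0 - curOpTT' L 0 * hubbardTorus 2 L 1 U) * hubbardTorus 2 L 1 U) *
        (hubbardTorus 2 L 1 U * curOpTT' L 0 - curOpTT' L 0 * hubbardTorus 2 L 1 U)) := by
    rw [conjTranspose_mul, hCh, hBa, mul_neg]
  rw [hstep1, re_star_dotProduct_mul_mulVec_eq_half _ _ hXY]
  -- (3) `[B, C]` is the translation sum of `Γ(m₃')`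
  have hcomm : star ψ ⬝ᵥ (((hubbardTorus 2 L 1 U * curOpTT' L 0 - curOpTT' L 0 * hubbardTorus 2 L 1 U) *
        (hubbardTorus 2 L 1 U * (hubbardTorus 2 L 1 U * curOpTT' L 0 - curOpTT' L 0 * hubbardTorus 2 L 1 U) -
          (hubbardTorus 2 L 1 U * curOpTT' L 0 - curOpTT' L 0 * hubbardTorus 2 L 1 U) * hubbardTorus 2 L 1 U) -
      (hubbardTorus 2 L 1 U * (hubbardTorus 2 L 1 U * curOpTT' L 0 - curOpTT' L 0 * hubbardTorus 2 L 1 U) -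
          (hubbardTorus 2 L 1 U * curOpTT' L 0 - curOpTT' L 0 * hubbardTorus 2 L 1 U) * hubbardTorus 2 L 1 U) *
        (hubbardTorus 2 L 1 U * curOpTT' L 0 - curOpTT' L 0 * hubbardTorus 2 L 1 U)) *ᵥ ψ) =
      ((L : ℂ) ^ 2) * torusAvgExpectAt L (box 2 7) (thirdMomentObs U) ψ := by
    have h := expect_commutator_sum_relabel_translate L hΩ hZ5 h27 h37
      (fun z hz => by simpa using shiftSet_subset_box_add (subset_refl (box 2 2)) hz)
      (fun a ha c hc => by simpa using sub_mem_box_add ha hc) (curDerivObs_mem_carEvenSubalgebra U)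
      (curDeriv2Obs U) ψ
    rw [← hubbardTorus_commutator_curOpTT' L U (by omega),
      ← hubbardTorus_commutator_commutator_curOpTT' L U (by omega)] at h
    exact h
  rw [hcomm, show ((L : ℂ) ^ 2 * torusAvgExpectAt L (box 2 7) (thirdMomentObs U) ψ).re =
      (L : ℝ) ^ 2 * (torusAvgExpectAt L (box 2 7) (thirdMomentObs U) ψ).re by
    rw [← Complex.ofReal_natCast, ← Complex.ofReal_pow, Complex.re_ofReal_mul]]
  ring

/-- **The per-site odd-moment functional of a sector ground state is a combination of torus averages
of LOCAL observables** (`L ≥ 15`): for every `(N_L, 0)`-sector ground state `ψ` of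
`hubbardTorus 2 L 1 U`,
`oddMomentFunctional U δ λ L ψ = ½Re avg(k₀) + λ Re avg(d₁) − (λ²/2) Re avg(m₃')`.
[cite: Lipparini2008, eq. (8.30)] -/
theorem oddMomentFunctional_eq_torusAvgExpect (U δ lam : ℝ) (hL : 15 ≤ L)
    {ψ : Fock (Orb (FermionTorus 2 L))}
    (hgs : IsGroundStateInSector (hubbardTorus 2 L 1 U) (2 * ⌊(1 - δ) * (L : ℝ) ^ 2 / 2⌋₊) 0 ψ) :
    oddMomentFunctional U δ lam L ψ =
      (torusAvgExpect L (box 2 1) kinBondObs ψ).re / 2 +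
        lam * (torusAvgExpect L (box 2 4) (firstMomentObs U) ψ).re -
        lam ^ 2 / 2 * (torusAvgExpect L (box 2 7) (thirdMomentObs U) ψ).re := by
  -- `Hψ = E₀ψ` with `E₀ = fluxEnergy L U δ 0`
  have hgs' : IsGroundStateInSector (hubbardTorusTT' L 1 0 U) (2 * ⌊(1 - δ) * (L : ℝ) ^ 2 / 2⌋₊) 0 ψ := by
    rw [hubbardTorusTT'_zero]; exact hgs
  have hE' : hubbardTorusTT' L 1 0 U *ᵥ ψ = ((fluxEnergyTT' L 0 U δ 0 : ℝ) : ℂ) • ψ := by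
    rw [fluxEnergyTT'_eq, hubbardTorusTT'Flux_zero]
    exact hgs'.2.2
  have hE : hubbardTorus 2 L 1 U *ᵥ ψ = ((fluxEnergy L U δ 0 : ℝ) : ℂ) • ψ := by
    rw [hubbardTorusTT'_zero, fluxEnergyTT'_tPrime_zero] at hE'
    exact hE'
  -- the kinetic term
  have h1 : Set.InjOn (Torus.proj (d := 2) L) ↑(box 2 1) := injOn_proj_box (by omega)
  have hkin : (star ψ ⬝ᵥ (kinOpTT' L 0 *ᵥ ψ)).re = (L : ℝ) ^ 2 * (torusAvgExpectAt L (box 2 1) kinBondObs ψ).re := by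
    rw [kinOpTT'_zero_eq_sum_translate L h1,
      show star ψ ⬝ᵥ ((∑ v : TorusSite 2 L, relabel (Orb.translate v)
        (fermionEmbed (PolySite.toTorusEmb L h1) kinBondObs)) *ᵥ ψ) =
        expect (∑ v : TorusSite 2 L, relabel (Orb.translate v)
          (fermionEmbed (PolySite.toTorusEmb L h1) kinBondObs)) ψ from rfl,
      expect_sum_relabel_translate_fermionEmbed' L h1, ← Complex.ofReal_natCast, ← Complex.ofReal_pow,
      Complex.re_ofReal_mul]
  have hLpos : (0 : ℝ) < (L : ℝ) ^ 2 := by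
    have : (0 : ℝ) < (L : ℝ) := Nat.cast_pos.2 (NeZero.pos L)
    positivity
  rw [oddMomentFunctional_eq, hkin, firstMoment_eq_torusAvgExpect L U (by omega) hE,
    thirdMoment_eq_torusAvgExpect L U hL hE, torusAvgExpect_eq, torusAvgExpect_eq, torusAvgExpect_eq]
  field_simp
  ring

end Finite

/-! ### The identification hypothesis of the `R-K3-TL` adapter, proved -/

/-- **IDENTIFICATION (the hypothesis `hId` of `fluxStiffness_le_of_torusLimit_oddMoment_row`, proved).**
Along every torus-limit sequence of `(rectN (1−δ) L, 0)`-sector ground states `ψ (Ls j)` of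
`hubbardTorus 2 (Ls j) 1 U` (`Ls → ∞`) with torus limit `ω`, the per-site fixed-`λ` odd-moment
functional converges to `oddMomentLimitFunctional U λ ω = ½Re ω(k₀) + λ Re ω(d₁) − (λ²/2) Re ω(m₃')`
(eventually `Ls j ≥ 15`, where it is the same combination of translation-averaged expectations of
the three local observables; then weak-⋆ convergence). [cite: BratteliRobinsonI1987, §4.3.1] -/
theorem tendsto_oddMomentFunctional_of_isTorusLimitOf (U δ lam : ℝ)
    (ω : InfVolFermionState 2) (Ls : ℕ → ℕ) (ψ : ∀ L, Fock (Orb (FermionTorus 2 L)))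
    (hLs : Tendsto Ls atTop atTop)
    (hgs : ∀ j, IsGroundStateInSector (hubbardTorus 2 (Ls j) 1 U) (rectN (1 - δ) (Ls j)) 0 (ψ (Ls j)))
    (hω : ω.IsTorusLimitOf ψ Ls) :
    Tendsto (fun j => oddMomentFunctional U δ lam (Ls j) (ψ (Ls j))) atTop
      (𝓝 (oddMomentLimitFunctional U lam ω)) := by
  have hlim : Tendsto (fun j => (torusAvgExpect (Ls j) (box 2 1) kinBondObs (ψ (Ls j))).re / 2 +
        lam * (torusAvgExpect (Ls j) (box 2 4) (firstMomentObs U) (ψ (Ls j))).re -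
        lam ^ 2 / 2 * (torusAvgExpect (Ls j) (box 2 7) (thirdMomentObs U) (ψ (Ls j))).re) atTop
      (𝓝 (oddMomentLimitFunctional U lam ω)) := by
    unfold oddMomentLimitFunctional
    exact ((((Complex.continuous_re.tendsto _).comp (hω _ kinBondObs)).div_const 2).add
      (((Complex.continuous_re.tendsto _).comp (hω _ (firstMomentObs U))).const_mul lam)).sub
      (((Complex.continuous_re.tendsto _).comp (hω _ (thirdMomentObs U))).const_mul (lam ^ 2 / 2))
  refine hlim.congr' ?_
  filter_upwards [hLs.eventually_ge_atTop 15] with j hj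
  haveI : NeZero (Ls j) := ⟨by omega⟩
  exact (oddMomentFunctional_eq_torusAvgExpect (Ls j) U δ lam hj (hgs j)).symm

/-- **The `R-K3-TL` row adapter, UNCONDITIONAL form.** Let `δ ≥ −1`, `λ ∈ ℝ`, and let `ρ_s, θ₀ > 0` be
a uniform flux stiffness of the zero-flux `(N_L, S^z = 0)` sectors of `hubbardTorus 2 L 1 U` along
all even `L ≥ L₀` (`ρ_s θ² ≤ E_L(θ) − E_L(0)` for `|θ| ≤ θ₀`). If a certificate gives
`oddMomentLimitFunctional U λ ω = ½Re ω(k₀) + λ Re ω(d₁) − (λ²/2) Re ω(m₃') ≤ q` for EVERY torus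
limit `ω` of unit sector ground states along sides `Ls → ∞` (the shape of the cell's window-SDP edge
`stiffK3` at fixed `λ`, objective `½kx + 2λU·d1U + λ²(U²m3T + U³m3U)` read on the local matrices
`k₀, d₁, m₃'`), then `ρ_s ≤ q` (tree units; `D_s^{HVR} = ρ_s/2`, `D^{SWZ}/(πe²) = 2ρ_s`). This is
`fluxStiffness_le_of_torusLimit_oddMoment_row` with its identification hypothesis discharged by
`tendsto_oddMomentFunctional_of_isTorusLimitOf`. [cite: Lipparini2008, eq. (8.30)]
[cite: ScalapinoWhiteZhang1993, §II] -/
theorem fluxStiffness_le_of_torusLimit_oddMoment_certificate {U δ ρs θ₀ q : ℝ} (lam : ℝ) (hδ : -1 ≤ δ)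
    (hθ₀ : 0 < θ₀) {L₀ : ℕ}
    (hst : ∀ (L : ℕ) [NeZero L], L₀ ≤ L → Even L →
      ∀ θ : ℝ, |θ| ≤ θ₀ → ρs * θ ^ 2 ≤ fluxEnergy L U δ θ - fluxEnergy L U δ 0)
    (hrow : ∀ (ω : InfVolFermionState 2) (Ls : ℕ → ℕ) (ψ : ∀ L, Fock (Orb (FermionTorus 2 L))),
      Tendsto Ls atTop atTop →
      (∀ j, IsGroundStateInSector (hubbardTorus 2 (Ls j) 1 U) (rectN (1 - δ) (Ls j)) 0 (ψ (Ls j))) →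
      (∀ j, star (ψ (Ls j)) ⬝ᵥ ψ (Ls j) = 1) → ω.IsTorusLimitOf ψ Ls →
        oddMomentLimitFunctional U lam ω ≤ q) :
    ρs ≤ q :=
  fluxStiffness_le_of_torusLimit_oddMoment_row lam hδ hθ₀ hst (oddMomentLimitFunctional U lam)
    (fun ω Ls ψ hLs hgs _ hω => tendsto_oddMomentFunctional_of_isTorusLimitOf U δ lam ω Ls ψ hLs hgs hω)
    hrow

/-- **Registry spelling** (`hubbardTorusTT' L 1 0 U = hubbardTorus 2 L 1 U`): the same adapter with the
ground-state class written over the `t–t'` torus at `t' = 0`, as the cell's certified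
thermodynamic-limit rows are typed. [cite: ScalapinoWhiteZhang1993, §II] -/
theorem fluxStiffness_le_of_torusLimit_oddMoment_certificate_TT'zero {U δ ρs θ₀ q : ℝ} (lam : ℝ)
    (hδ : -1 ≤ δ) (hθ₀ : 0 < θ₀) {L₀ : ℕ}
    (hst : ∀ (L : ℕ) [NeZero L], L₀ ≤ L → Even L →
      ∀ θ : ℝ, |θ| ≤ θ₀ → ρs * θ ^ 2 ≤ fluxEnergy L U δ θ - fluxEnergy L U δ 0)
    (hrow : ∀ (ω : InfVolFermionState 2) (Ls : ℕ → ℕ) (ψ : ∀ L, Fock (Orb (FermionTorus 2 L))),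
      Tendsto Ls atTop atTop →
      (∀ j, IsGroundStateInSector (hubbardTorusTT' (Ls j) 1 0 U) (rectN (1 - δ) (Ls j)) 0 (ψ (Ls j))) →
      (∀ j, star (ψ (Ls j)) ⬝ᵥ ψ (Ls j) = 1) → ω.IsTorusLimitOf ψ Ls →
        oddMomentLimitFunctional U lam ω ≤ q) :
    ρs ≤ q := by
  refine fluxStiffness_le_of_torusLimit_oddMoment_certificate lam hδ hθ₀ hst fun ω Ls ψ hLs hψ h1 hω => ?_
  exact hrow ω Ls ψ hLs (fun j => by simpa only [hubbardTorusTT'_zero] using hψ j) h1 hω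

end Summit.Ventures.CertifiedManyBodySolver.Observables

end
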